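import Summits.BirchSwinnertonDyer.BirchSwinnertonDyer.Theorems.KolyvaginRoadThreeConductorOneData
import HarnessLib

/-!
# Route `KolyvaginRoadThree`, crux `ZhangSharpFrameAtThree` (item stmt-BirchSwinnertonDyer-19153): the A1
# kernel with the crux's hypothesis RESTRICTED TO CLASS X11b (the one-binder variant the judge's restate (a)
# needs; cell `bsd-stepL`, seat `bsd-stepL-zhang3-p1`; `--supports 19153`, helper)

THEOREMS ONLY (no definition, no named fact, no `sorry`); nothing about Kolyvagin's conjecture at `p = 3` is
asserted; CONDITIONAL on every binder; nothing is booked (PARTITION: O2@3 × A1 (1 116 TRUE-OPEN classes; cw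
248 943) — types-the-object-of; closes: none).

WHY. The route's deciding crux `Theses.KolyvaginRoadThree.ZhangSharpFrameAtThree` (= hypothesis `hZ` of the A1
kernel `Koly.bsdp_three_onA1_of_kolyvaginFrames`, `Theorems/ClassRecordThreeKolyGlue.lean`, koly p410690) has NO
analytic-rank binder: as typed it asserts Kolyvagin's conjecture mod 3 at every Manin-good conductor-1 frame of
every curve with `3 ∥ N` multiplicative, `ρ̄_{E,3}` onto, a (ram) prime and `3 ∤ ∏ c_ℓ` — in analytic rank
`≥ 2` too (tribunal T1 advisory t1-2 4abb7cbb 2026-08-26T03:32Z; W. Zhang 2014, Remark 5). The route needs it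
only for pairs `(E, 3) ∈ X11b` (analytic rank one): the kernel applies `hZ` exactly once, at the curve `W` in
hand, with `hX : ClassX11b W 3` in context (KolyGlue l.133). The judge's direction (a) restates the item with
ONE binder `Summit.BirchSwinnertonDyer.Rank1Residual.ClassX11b W 3 →` inserted after `(ι : K →+* ℂ),`
(planner g23, `plan/KOLY-19153-package/Restate19153-Sketch.lean`, 33272eec79a52d85); for the re-certified
`closes` to elaborate, the A1 kernel must accept `hZ` in that RESTRICTED shape. This file supplies it:

* `Koly.bsdp_three_onA1_of_kolyvaginFramesX11b` — the A1 kernel VERBATIM (same published binders, same seam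
  `hKD`, same proof) with `hZ` carrying the extra binder `ClassX11b W 3 →` and the route decl's spelling of
  the other binders (`Rank1Residual.Surj W 3`, `Rank1Residual.Ram W 3`, reducibly equal to the kernel's
  `HasSurjectiveModNGaloisRep 3` ∕ `∃ ℓ …`), so that the restated item feeds it by `exact h₁`;
* `Koly.kolyvaginFramesX11b_of_kolyvaginFrames` — the filed (unrestricted) shape implies the restricted one
  (the restate is WEAKER), so the filed kernel `bsdp_three_onA1_of_kolyvaginFrames` is the variant composed
  with it (not restated here: same type as the landed kernel);
* `Theorems.bsdp_three_onA1_of_kolyvaginFramesX11b_of_darmon36` — the variant with seam G-a DISCHARGED by the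
  named fact `phi_heegnerTau_mem_range_map_singularModuliField` (Darmon 2004 Thm. 3.6 at conductor 1), the
  twin of koly's `bsdp_three_onA1_of_kolyvaginFrames_of_darmon36` (`KolyvaginRoadThreeConductorOneData.lean`).

GLUE NOTE for the planner (no Theses import here, so the route file may import this module): after
`--restate ZhangSharpFrameAtThree` to the staged statement, the `closes` body of rev 3 elaborates unchanged
except for the kernel's name in the A1 case:
`(fun W _ _ hX hram htam ↦ Summit.BirchSwinnertonDyer.Rank1Residual.X11b.Three.Koly.bsdp_three_onA1_of_kolyvaginFramesX11b
hGZ hKo hB hSk hGZK hmod hnf hHL hMaz hrec hMc hKD g₁ W hX hram htam)` — the seat farm-checks this full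
`closes` term against the staged decl once this module is in the tree (`work/ClosesRestated19153.lean`,
attached as evidence on item 19153).

References (locators only): [cite: WZhang2014, Thm. 1.1 and Remark 5 (analytic rank one)]
[cite: McCallumLMS1991, §5 Cor. 5.6 (p. 310)] [cite: GrossLMS1991, §4 (4.1) and Thm. 1.3]
[cite: Darmon2004, Thm. 3.6 (PDF pp. 43–44)].
-/

noncomputable section

open scoped Classical

namespace Summit.BirchSwinnertonDyer.Rank1Residual.X11b.Three.Koly

open WeierstrassCurve Literature.NumberTheory.EllipticCurves
  Literature.NumberTheory.EllipticCurves.ModularForms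
  Literature.NumberTheory.EllipticCurves.Rank1Residual
  Summit.BirchSwinnertonDyer.Rank1Residual Summit.BirchSwinnertonDyer.Rank1Residual.X11b

/-- **The A1 kernel of route `KolyvaginRoadThree` with Kolyvagin's conjecture mod 3 asked ONLY ON CLASS X11b.**
Under the published named facts (Gross–Zagier, Kolyvagin ×2, Skinner 2016 Thm C, GZK, modularity, newforms,
Hoffstein–Luo, Mazur's Manin constant, Shimura reciprocity at conductor 1 `hrec`, McCallum's structure theorem
`hMc`), the existence of conductor-1 Kolyvagin–Heegner data on admissible frames (`hKD`, seam G-a) and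
Kolyvagin's conjecture mod 3 at `3 ∥ N` at every Manin-good frame OF A CURVE OF CLASS X11b AT 3 (`hZ`: the
judge's restated item 19153, binder `ClassX11b W 3` first, then verbatim the filed binders in the route's
spelling `Surj`∕`Ram`): for every `E/ℚ` with `(E,3) ∈ X11b`, a (ram) prime and `3 ∤ ∏_ℓ c_ℓ(E)`, `BSDp W 3`.
Proof: koly's `bsdp_three_onA1_of_kolyvaginFrames` VERBATIM — one odd Heegner datum with a Manin-good frame
(`exists_oddHeegnerData`: Hoffstein–Luo field, Mazur, `w_K = 2`), the conductor-1 datum from `hKD`, the bottom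
point `P(1) = y_K` (`hrec`), non-torsion (Gross–Zagier), rank one and `Ш` finite (Kolyvagin), `E(K)[3] = 0`,
`3^{M₀} ∥ y_K` (Mordell–Weil), then `hZ` AT THIS CURVE (where `hX : ClassX11b W 3` is in hand — the only
change) and the end-to-end theorem `ClassX11b.bsdp_three_of_kolyvaginClass_one_ne_zero_of_mccallum`.
CONDITIONAL on every binder; nothing booked. [cite: McCallumLMS1991, §5 Cor. 5.6 (p. 310)]
[cite: GrossLMS1991, §4 (4.1) and Thm. 1.3] [cite: WZhang2014, Remark 5 (analytic rank one)] -/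
theorem bsdp_three_onA1_of_kolyvaginFramesX11b
    -- published named facts
    (hGZ : ∀ (N : ℕ) [NeZero N] (W : WeierstrassCurve ℚ) (K : Type) [Field K] [NumberField K],
      gross_zagier N W K)
    (hKo : ∀ (N : ℕ) [NeZero N] (W : WeierstrassCurve ℚ) (K : Type) [Field K] [NumberField K],
      kolyvagin N W K)
    (hB : ∀ (N : ℕ) [NeZero N] (W : WeierstrassCurve ℚ) (K : Type) [Field K] [NumberField K],
      Kolyvagin1990_padicValNat_card_sha_le N W K)
    (hSk : Skinner2016.thmC_padicValRat_bsd_rank_zero)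
    (hGZK : rank_eq_analyticRank_of_analyticRank_le_one) (hmod : hasEntireLFunction_rat)
    (hnf : exists_isNewformOf) (hHL : HoffsteinLuo1997_exists_twist_L_one_ne_zero)
    (hMaz : mazur_not_dvd_maninConstant_of_odd)
    (hrec : ∀ (N : ℕ) [NeZero N] (W : WeierstrassCurve ℚ) (K : Type) [Field K] [NumberField K],
      heegnerPointOfConductor_one_galoisConj N W K)
    (hMc : McCallum1991_pow_dvd_card_sha_primary_of_certificate)
    -- SEAM G-a: conductor-1 Kolyvagin–Heegner data exist on every admissible frame (CM theory; hypothesis shape)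
    (hKD : ∀ (W : WeierstrassCurve ℚ) [W.IsElliptic] [W.IsGloballyMinimal] [NeZero (W.conductorNorm ℤ)]
      (K : Type) [Field K] [NumberField K]
      (Dt : ModularParametrizationData W (W.conductorNorm ℤ)) (β : ℤ) (ι : K →+* ℂ),
      IsImaginaryQuadratic K → SatisfiesHeegnerHypothesis (W.conductorNorm ℤ) K →
      (4 * (W.conductorNorm ℤ : ℤ)) ∣ β ^ 2 - NumberField.discr K →
      Nonempty (KolyvaginHeegnerData Dt β ι 1))
    -- SEAM G-b RESTRICTED: Kolyvagin's conjecture mod 3 at 3 ∥ N at every Manin-good frame of a CLASS-X11b curve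
    (hZ : ∀ (W : WeierstrassCurve ℚ) [W.IsElliptic] [W.IsGloballyMinimal] [NeZero (W.conductorNorm ℤ)]
      (K : Type) [Field K] [NumberField K]
      (Dt : ModularParametrizationData W (W.conductorNorm ℤ)) (β : ℤ) (ι : K →+* ℂ),
      ClassX11b W 3 → W.HasMultiplicativeReductionAtPrime 3 → Rank1Residual.Surj W 3 →
      Rank1Residual.Ram W 3 → ¬ 3 ∣ W.tamagawaProduct →
      IsImaginaryQuadratic K → SatisfiesHeegnerHypothesis (W.conductorNorm ℤ) K →
      NumberField.discr K ≠ -3 →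
      (4 * (W.conductorNorm ℤ : ℤ)) ∣ β ^ 2 - NumberField.discr K → ¬ (3 : ℤ) ∣ Dt.c →
      ∃ (n : ℕ) (d : KolyvaginHeegnerData Dt β ι n),
        KolyvaginDescent.KolSupp (Zhang2014.IsKolyvaginPrime (W.conductorNorm ℤ) W K 3) n ∧
          d.kolyvaginClass Nat.prime_three 1 ≠ 0)
    -- the pair
    (W : WeierstrassCurve ℚ) [W.IsElliptic] [W.IsGloballyMinimal]
    (hX : ClassX11b W 3) (hram : Ram W 3) (htam : ¬ 3 ∣ W.tamagawaProduct) : BSDp W 3 := by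
  haveI : NeZero (W.conductorNorm ℤ) := ⟨(W.conductorNorm_pos_holds).ne'⟩
  have hmult : W.HasMultiplicativeReductionAtPrime 3 := hX.2.2.1
  have hirr : Irr W 3 := hX.2.2.2
  have hρ : Surj W 3 := surj_of_irr_of_ram W 3 hirr hram
  -- ONE odd Heegner datum with a Manin-good frame (Hoffstein–Luo field; Mazur; w_K = 2)
  obtain ⟨K, _, _, Dt, H, ι, P, Wd, _, _, Cd, hK, hodd, h3d, hHN, hP, hc, hμ, hLt, hWd⟩ :=
    exists_oddHeegnerData hnf hHL hMaz integral_neronScaling_of_isGloballyMinimal_holds W 3 hX.1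
      (by decide) hmult hirr
  have h3 : NumberField.discr K ≠ -3 := by
    intro h
    exact h3d (h ▸ ⟨-1, by norm_num⟩)
  -- seam G-a: a conductor-1 Kolyvagin–Heegner datum on the frame (Dt, H.β, ι)
  obtain ⟨d₁⟩ := hKD W K Dt H.β ι hK hHN H.dvd_sq_sub
  -- the bottom point: P(1) = y_K = P in E(K̄) (Shimura reciprocity at conductor 1, named fact `hrec`)
  have hPd : d₁.toGeomPoints d₁.derivedPoint = toGeomPoints (W.baseChange K) P :=
    KolyvaginBottom.toGeomPoints_derivedPoint_one_eq (hrec _ W K) hK hHN hP d₁ rfl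
  -- y_K is non-torsion (Gross–Zagier at r_an = 1 with L(E^{d_K},1) ≠ 0); rank one, Ш finite (Kolyvagin)
  have hPinf : ¬ IsOfFinAddOrder P :=
    not_isOfFinAddOrder_of_heegner_of_analyticRank_eq_one W (W.conductorNorm ℤ) K Dt H ι P (hGZ _ W K) hmod
      hX.1 hK hHN hLt hP
  obtain ⟨hrank, hSha⟩ := hKo (W.conductorNorm ℤ) W K hK hHN ⟨Dt, H, ι, hP⟩ hPinf
  haveI : Finite (W.baseChange K).sha := hSha
  -- E(K)[3] = 0 (E[3] irreducible, K imaginary quadratic)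
  have hbot := torsionBy_eq_bot_of_isImaginaryQuadratic_of_hasIrreducibleModPGaloisRep W K hK
    Nat.prime_three hirr
  have hiv : ∀ x : (W.baseChange K).toAffine.Point, 3 • x = 0 → x = 0 := fun x hx ↦ by
    have hmem : x ∈ AddSubgroup.torsionBy (W.baseChange K).toAffine.Point ((3 : ℕ) : ℤ) := by
      rw [mem_torsionBy_iff, natCast_zsmul]
      exact hx
    rw [hbot] at hmem
    exact hmem
  -- the exponent 3^{M₀} ∥ y_K (Mordell–Weil)
  haveI : Module.Finite ℤ (W.baseChange K).toAffine.Point := (W.baseChange K).module_finite_point_holds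
  obtain ⟨M₀, x₀, hx₀, hmax⟩ := exists_pow_smul_eq_and_forall_ne hPinf (p := 3) (by norm_num)
  have hdiv : ∃ Q : (W.baseChange K).toAffine.Point, ((3 ^ M₀ : ℕ) : ℤ) • Q = P :=
    ⟨x₀, by rw [natCast_zsmul]; exact hx₀⟩
  have hndiv : ¬ ∃ Q : (W.baseChange K).toAffine.Point, ((3 ^ (M₀ + 1) : ℕ) : ℤ) • Q = P := by
    rintro ⟨Q, hQ⟩
    exact hmax Q (by rw [← natCast_zsmul]; exact hQ)
  -- seam G-b RESTRICTED: Kolyvagin's conjecture mod 3 at this Manin-good frame OF THIS class-X11b curve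
  obtain ⟨n, d, hn, hne⟩ := hZ W K Dt H.β ι hX hmult hρ hram htam hK hHN h3 H.dvd_sq_sub hc
  -- the end-to-end theorem at this datum
  exact ClassX11b.bsdp_three_of_kolyvaginClass_one_ne_zero_of_mccallum W K Dt H ι P (hGZ _ W K) (hKo _ W K)
    (hB _ W K) hSk hGZK hmod hX hram htam hK hodd hHN hP hc hLt Wd Cd hWd H.β d₁ hPd hPinf hrank hiv hdiv hndiv
    d hn hne hMc

/-- **The filed ∀-frame shape of the crux implies the class-X11b-restricted shape** (the judge's restate (a)
is WEAKER: the rank-blind surplus is dropped, nothing the route uses is lost). Pure logic: ignore the extra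
binder. Matches `Staged.zhangSharpFrameAtThreeX11b_of_old` of the planner's sketch (33272eec79a52d85), in the
kernel's hypothesis spelling; composing with `bsdp_three_onA1_of_kolyvaginFramesX11b` recovers koly's filed
kernel `bsdp_three_onA1_of_kolyvaginFrames` (p410690), so nothing is lost. [folklore] -/
theorem kolyvaginFramesX11b_of_kolyvaginFrames
    (hZ : ∀ (W : WeierstrassCurve ℚ) [W.IsElliptic] [W.IsGloballyMinimal] [NeZero (W.conductorNorm ℤ)]
      (K : Type) [Field K] [NumberField K]
      (Dt : ModularParametrizationData W (W.conductorNorm ℤ)) (β : ℤ) (ι : K →+* ℂ),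
      W.HasMultiplicativeReductionAtPrime 3 → Rank1Residual.Surj W 3 →
      Rank1Residual.Ram W 3 → ¬ 3 ∣ W.tamagawaProduct →
      IsImaginaryQuadratic K → SatisfiesHeegnerHypothesis (W.conductorNorm ℤ) K →
      NumberField.discr K ≠ -3 →
      (4 * (W.conductorNorm ℤ : ℤ)) ∣ β ^ 2 - NumberField.discr K → ¬ (3 : ℤ) ∣ Dt.c →
      ∃ (n : ℕ) (d : KolyvaginHeegnerData Dt β ι n),
        KolyvaginDescent.KolSupp (Zhang2014.IsKolyvaginPrime (W.conductorNorm ℤ) W K 3) n ∧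
          d.kolyvaginClass Nat.prime_three 1 ≠ 0) :
    ∀ (W : WeierstrassCurve ℚ) [W.IsElliptic] [W.IsGloballyMinimal] [NeZero (W.conductorNorm ℤ)]
      (K : Type) [Field K] [NumberField K]
      (Dt : ModularParametrizationData W (W.conductorNorm ℤ)) (β : ℤ) (ι : K →+* ℂ),
      ClassX11b W 3 → W.HasMultiplicativeReductionAtPrime 3 → Rank1Residual.Surj W 3 →
      Rank1Residual.Ram W 3 → ¬ 3 ∣ W.tamagawaProduct →
      IsImaginaryQuadratic K → SatisfiesHeegnerHypothesis (W.conductorNorm ℤ) K →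
      NumberField.discr K ≠ -3 →
      (4 * (W.conductorNorm ℤ : ℤ)) ∣ β ^ 2 - NumberField.discr K → ¬ (3 : ℤ) ∣ Dt.c →
      ∃ (n : ℕ) (d : KolyvaginHeegnerData Dt β ι n),
        KolyvaginDescent.KolSupp (Zhang2014.IsKolyvaginPrime (W.conductorNorm ℤ) W K 3) n ∧
          d.kolyvaginClass Nat.prime_three 1 ≠ 0 :=
  fun W _ _ _ K _ _ Dt β ι _ ↦ hZ W K Dt β ι

end Summit.BirchSwinnertonDyer.Rank1Residual.X11b.Three.Koly

namespace Summit.BirchSwinnertonDyer.BirchSwinnertonDyer.Theorems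

open WeierstrassCurve Literature.NumberTheory.EllipticCurves
  Literature.NumberTheory.EllipticCurves.ModularForms
  Literature.NumberTheory.EllipticCurves.Rank1Residual
  Summit.BirchSwinnertonDyer.Rank1Residual Summit.BirchSwinnertonDyer.Rank1Residual.X11b

/-- **The restricted A1 kernel with seam G-a DISCHARGED by name** (twin of koly's
`bsdp_three_onA1_of_kolyvaginFrames_of_darmon36`): `Koly.bsdp_three_onA1_of_kolyvaginFramesX11b` with `hKD`
supplied by Darmon 2004 Thm. 3.6 at conductor 1 (`phi_heegnerTau_mem_range_map_singularModuliField`, via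
`kolyvaginRoadThree_hKD_of_darmon36`). Under the published named facts and the deciding crux RESTRICTED TO
CLASS X11b in hypothesis shape `hZ` (the judge's restate (a) of item 19153): `BSD(E,3)` for every `E` on
atom A1 (`(E,3) ∈ X11b`, (ram), `3 ∤ ∏c`). CONDITIONAL on every binder; nothing booked.
[cite: Darmon2004, Thm. 3.6 (PDF pp. 43–44)] [cite: McCallumLMS1991, §5 Cor. 5.6 (p. 310)]
[cite: GrossLMS1991, §4 (4.1) and Thm. 1.3] -/
theorem bsdp_three_onA1_of_kolyvaginFramesX11b_of_darmon36
    (hGZ : ∀ (N : ℕ) [NeZero N] (W : WeierstrassCurve ℚ) (K : Type) [Field K] [NumberField K],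
      gross_zagier N W K)
    (hKo : ∀ (N : ℕ) [NeZero N] (W : WeierstrassCurve ℚ) (K : Type) [Field K] [NumberField K],
      kolyvagin N W K)
    (hB : ∀ (N : ℕ) [NeZero N] (W : WeierstrassCurve ℚ) (K : Type) [Field K] [NumberField K],
      Kolyvagin1990_padicValNat_card_sha_le N W K)
    (hSk : Skinner2016.thmC_padicValRat_bsd_rank_zero)
    (hGZK : rank_eq_analyticRank_of_analyticRank_le_one) (hmod : hasEntireLFunction_rat)
    (hnf : exists_isNewformOf) (hHL : HoffsteinLuo1997_exists_twist_L_one_ne_zero)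
    (hMaz : mazur_not_dvd_maninConstant_of_odd)
    (hrec : ∀ (N : ℕ) [NeZero N] (W : WeierstrassCurve ℚ) (K : Type) [Field K] [NumberField K],
      heegnerPointOfConductor_one_galoisConj N W K)
    (hMc : McCallum1991_pow_dvd_card_sha_primary_of_certificate)
    (h36 : ∀ (N : ℕ) [NeZero N] (W : WeierstrassCurve ℚ) (K : Type) [Field K] [NumberField K],
      phi_heegnerTau_mem_range_map_singularModuliField N W K)
    (hZ : ∀ (W : WeierstrassCurve ℚ) [W.IsElliptic] [W.IsGloballyMinimal] [NeZero (W.conductorNorm ℤ)]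
      (K : Type) [Field K] [NumberField K]
      (Dt : ModularParametrizationData W (W.conductorNorm ℤ)) (β : ℤ) (ι : K →+* ℂ),
      ClassX11b W 3 → W.HasMultiplicativeReductionAtPrime 3 → Rank1Residual.Surj W 3 →
      Rank1Residual.Ram W 3 → ¬ 3 ∣ W.tamagawaProduct →
      IsImaginaryQuadratic K → SatisfiesHeegnerHypothesis (W.conductorNorm ℤ) K →
      NumberField.discr K ≠ -3 →
      (4 * (W.conductorNorm ℤ : ℤ)) ∣ β ^ 2 - NumberField.discr K → ¬ (3 : ℤ) ∣ Dt.c →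
      ∃ (n : ℕ) (d : KolyvaginHeegnerData Dt β ι n),
        KolyvaginDescent.KolSupp (Zhang2014.IsKolyvaginPrime (W.conductorNorm ℤ) W K 3) n ∧
          d.kolyvaginClass Nat.prime_three 1 ≠ 0)
    (W : WeierstrassCurve ℚ) [W.IsElliptic] [W.IsGloballyMinimal]
    (hX : ClassX11b W 3) (hram : Ram W 3) (htam : ¬ 3 ∣ W.tamagawaProduct) : BSDp W 3 :=
  Summit.BirchSwinnertonDyer.Rank1Residual.X11b.Three.Koly.bsdp_three_onA1_of_kolyvaginFramesX11b hGZ hKo hB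
    hSk hGZK hmod hnf hHL hMaz hrec hMc (kolyvaginRoadThree_hKD_of_darmon36 h36) hZ W hX hram htam

end Summit.BirchSwinnertonDyer.BirchSwinnertonDyer.Theorems

end
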